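import Summits.RiemannHypothesis.RiemannHypothesis.Theses.PluckedString
import Literature.NumberTheory.LFunctions.ZetaScrewHermitianFormsProofs

/-!
# Route `PluckedString`, support item `PsiWeilIdentity` (stmt-RiemannHypothesis-2623) — CLOSED by name

Suzuki 2023, Prop. 3.1 in the tree's normalisation, unconditional: for every Weil test `g`,
`weilQuadratic g = ∫∫ (Ψ(t) + Ψ(u) − Ψ(t − u)) g'(u) conj g'(t) du dt` with `Ψ = zetaScrew`
(the route states `Ψ` as the inlined `let`, which is `zetaScrew` by `rfl`, `zetaScrew_def`).
The proof is the landed Literature theorem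
`Literature.NumberTheory.LFunctions.weilQuadratic_eq_integral_zetaScrewKernel`
(`ZetaScrewHermitianFormsProofs`, p426532, typed by rh-crit-dbl-t8; this 3-line closer was attached by that
seat as item evidence `PsiWeilIdentity_evidence.lean` and is filed verbatim by a prover seat, since
`Summits/…/Theorems` is prover-only).  LABEL: RH-FREE identity (an unconditional formula for the Weil
quadratic form); it is NOT positivity and not progress toward RH — nothing here bears on the truth of RH.
-/

-- `Summit.RiemannHypothesis.RiemannHypothesis.…` duplicates `RiemannHypothesis` BY DESIGN (D-0017).
set_option linter.dupNamespace false

namespace Summit.RiemannHypothesis.RiemannHypothesis.Theorems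

/-- **`PsiWeilIdentity`** (route `PluckedString`, item stmt-RiemannHypothesis-2623): Suzuki 2023 Prop. 3.1 —
`weilQuadratic g = ∫ t, ∫ u, (Ψ t + Ψ u − Ψ (t − u)) · (g′ u · conj (g′ t))` for every Weil test `g`,
`Ψ = zetaScrew` (definitionally the route's inlined `let Ψ`).  Proof: the Literature theorem
`weilQuadratic_eq_integral_zetaScrewKernel` (explicit formula + Suzuki Thm 1.1(2)), verbatim. -/
theorem PsiWeilIdentity_proof :
    Summit.RiemannHypothesis.RiemannHypothesis.Theses.PluckedString.PsiWeilIdentity :=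
  fun _ hg ↦ Literature.NumberTheory.LFunctions.weilQuadratic_eq_integral_zetaScrewKernel hg

end Summit.RiemannHypothesis.RiemannHypothesis.Theorems
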